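import Summits.CriticalPhenomena.PercolationContinuityZ3.Theorems.PercNearOneGluingNoHeavySamePDefs
import Summits.CriticalPhenomena.PercolationContinuityZ3.Theorems.Transplant.StatementBoxProdZ2
import Literature.Probability.LatticeModels.ThermodynamicLimit
import Mathlib.Combinatorics.SimpleGraph.Prod
import HarnessLib

/-!
# Interface Φ0 (product form) — the `p`-slice of the same-`p` witness and the tube / prism vocabulary
# of `X □ ℤ²`

builds on p205010 (kernel theorem, internal audit signed; external expert review pending).
Status sentence (coordinator 2026-08-20T04:30Z): "θ(p_c) = 0 on ℤ^d, all d ≥ 2 — kernel-verified (Lean 4/Mathlib,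
standard axioms); internal adversarial audit SIGNED 2026-08-20 04:29Z; external expert review pending."

Lane `prim-bschramm` (design `LADDER.md` v4 / `BLUEPRINT-I-PHI.md` §6–§7, NOT a theorem), seat `prim-bschramm-lead`
on behalf of the ended seat p4.  DEFINITIONS ONLY plus two one-line consequences of p4's continuation principle:

* `SameP.SamePWitnessAt G x p` — the `p`-slice of p4's `SameP.SamePWitness` (a lawful bounded-envelope
  history-driven scheme AT THE ONE DENSITY `p` whose infinite macro-cluster forces `x ↔ ∞`);
  `SameP.samePWitness_iff` (definitional unfolding) and `SameP.theta_criticalProb_eq_zero_of_samePWitnessAt`: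
  a witness at `p = p_c(G,x)` alone (vacuously available when `θ_x(p_c) = 0`) gives `θ_x(p_c) = 0` — the
  continuation principle `SameP.criticalProb_lt_of_lawful` (p207164) is used at the single density `p_c`.
* `Transplant.BoxProdZ2.tube W ℓ = W × {-ℓ,…,ℓ}²` (all fibres over a skeleton box; `W` = vertex type of `X`), `Transplant.BoxProdZ2.prism X x R c ℓ
  = B_X(x,R) × (c + {-ℓ,…,ℓ}²)` (fibre ball × square — the macro-box of the product re-typing of Kozma–Nitzan §4),
  `Transplant.BoxProdZ2.TubeSubcritical X p` (no tube percolates at density `p`; at `p = p_c(X □ ℤ²)` this is a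
  Martineau–Severo strict inequality, tree device p208012).

These are the names against which the lane's conjecture node `SamePWitnessBoxProdZ2` (seat stmt), the generic
tube lemma (seat p3) and the prism/face library (seat p2) are typed.  Nothing here is asserted about any open
statement. [cite: KozmaNitzan2024, §1 p. 2 (approach 1); §4 p. 15 (boxes)] [cite: BenjaminiSchramm1996, Conj. 4]
-/

noncomputable section

namespace Summit.CriticalPhenomena.PercolationContinuityZ3.Theorems

open MeasureTheory Literature.Probability.Percolation Literature.Probability.LatticeModels
open Literature.Barriers.CriticalPhenomena (graphBall)

namespace SameP

variable {V : Type*}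

/-- **The `p`-slice of the same-`p` witness** (`SameP.SamePWitness G x = ∀ p, 0 < θ_x(p) → SamePWitnessAt G x p`):
a history-driven site-renormalisation scheme on `G`, lawful at `(p, ε)` with `ε < 2⁻³²`, probe envelopes of at
most `N` edges, `U₀ ⊆ E(G)`, whose infinite final macro-cluster forces `x ↔ ∞` up to the null set `{ω ⊄ E(G)}`.
[cite: KozmaNitzan2024, §4 p. 25 (Definition of an exploration process)] -/
def SamePWitnessAt (G : SimpleGraph V) (x : V) (p : unitInterval) : Prop :=
  ∃ (S : HSiteScheme V) (ε : ℝ) (N : ℕ), S.Lawful G p ε ∧ ε < (1 / 2) ^ 32 ∧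
    (∀ h P, S.E.next h = some P → P.env.card ≤ N) ∧ (↑S.U₀ : Set (Sym2 V)) ⊆ G.edgeSet ∧
    S.initEvent ∩ {ω | (S.occFinal ω).Infinite} ⊆ percolatesAt x ∪ {ω | ¬ω ⊆ G.edgeSet}

/-- `SamePWitness` is the conjunction of its `p`-slices over the percolative densities (definitional).
[cite: KozmaNitzan2024, §1 p. 2 (approach 1)] -/
theorem samePWitness_iff (G : SimpleGraph V) (x : V) :
    SamePWitness G x ↔ ∀ p : unitInterval, 0 < theta G x p → SamePWitnessAt G x p :=
  Iff.rfl

/-- **A witness at the critical density alone gives `θ_x(p_c) = 0`** (any graph with countably many vertices):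
if `θ_x(p_c) > 0` the witness is a lawful scheme at `p_c`, and the continuation principle
`SameP.criticalProb_lt_of_lawful` yields `p_c < p_c`.  [cite: KozmaNitzan2024, §1 p. 2 (approach 1)] -/
theorem theta_criticalProb_eq_zero_of_samePWitnessAt [Countable V] (G : SimpleGraph V) (x : V)
    (h : 0 < theta G x ⟨criticalProb G x, criticalProb_mem_Icc G x⟩ →
      SamePWitnessAt G x ⟨criticalProb G x, criticalProb_mem_Icc G x⟩) :
    theta G x ⟨criticalProb G x, criticalProb_mem_Icc G x⟩ = 0 := by
  by_contra hne
  have hpos : 0 < theta G x ⟨criticalProb G x, criticalProb_mem_Icc G x⟩ :=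
    lt_of_le_of_ne measureReal_nonneg (Ne.symm hne)
  obtain ⟨S, ε, N, hL, hε, hN, hU, hperc⟩ := h hpos
  have hp0 : 0 < criticalProb G x := by
    rcases (criticalProb_mem_Icc G x).1.eq_or_lt with h0 | h0
    · exfalso
      have : theta G x ⟨criticalProb G x, criticalProb_mem_Icc G x⟩ = 0 := by
        have e : (⟨criticalProb G x, criticalProb_mem_Icc G x⟩ : unitInterval) = 0 :=
          Subtype.ext h0.symm
        rw [e]; exact theta_bot G x
      exact hne this
    · exact h0
  exact lt_irrefl _ (criticalProb_lt_of_lawful hL hε hN hU hp0 hperc)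

/-- The same at the tree's `criticalProbIOf G x : unitInterval` (definitionally `⟨p_c, _⟩`). [folklore] -/
theorem theta_criticalProbIOf_eq_zero_of_samePWitnessAt {U : Type} [Countable U] (G : SimpleGraph U) (x : U)
    (h : 0 < theta G x (criticalProbIOf G x) → SamePWitnessAt G x (criticalProbIOf G x)) :
    theta G x (criticalProbIOf G x) = 0 :=
  theta_criticalProb_eq_zero_of_samePWitnessAt G x h

end SameP

namespace Transplant.BoxProdZ2

variable {W : Type}

/-- **Tube of half-width `ℓ`**: all fibres of `X □ ℤ²` over the skeleton box `{-ℓ,…,ℓ}²`, i.e. `X × {-ℓ,…,ℓ}²`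
as a set of vertices of the product (induced graph = `X □` the `(2ℓ+1) × (2ℓ+1)` grid).
[cite: KozmaNitzan2024, §4 p. 15 (boxes)] -/
def tube (W : Type) (ℓ : ℕ) : Set (W × Site 2) :=
  {v | v.2 ∈ box 2 ℓ}

/-- Membership in a tube is a condition on the skeleton coordinate only. [folklore] -/
@[simp] theorem mem_tube (ℓ : ℕ) (v : W × Site 2) : v ∈ tube W ℓ ↔ v.2 ∈ box 2 ℓ :=
  Iff.rfl

/-- The roots `(w, 0)` lie in every tube. [folklore] -/
theorem mem_tube_zero (w : W) (ℓ : ℕ) : (w, (0 : Site 2)) ∈ tube W ℓ := by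
  rw [mem_tube]; exact zero_mem_box 2 ℓ

/-- Tubes increase with the half-width. [folklore] -/
theorem tube_mono {ℓ ℓ' : ℕ} (h : ℓ ≤ ℓ') : tube W ℓ ⊆ tube W ℓ' := by
  intro v hv
  rw [mem_tube, mem_box] at hv ⊢
  intro i
  have := hv i
  constructor <;> omega

/-- **Prism** (macro-box of the product re-typing): the fibre ball `B_X(x, R)` times the skeleton square
`c + {-ℓ,…,ℓ}²`.  Kozma–Nitzan's box `Λ_n ⊆ ℤ^d` becomes `prism X x R c ℓ` with the pair `(R, ℓ)` for `n`
(fibre radius chosen last, BLUEPRINT-I-PHI §2). [cite: KozmaNitzan2024, §4 p. 15 (boxes)] -/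
def prism (X : SimpleGraph W) (x : W) (R : ℕ) (c : Site 2) (ℓ : ℕ) : Set (W × Site 2) :=
  {v | v.1 ∈ graphBall X x R ∧ v.2 - c ∈ box 2 ℓ}

/-- Membership in a prism. [folklore] -/
@[simp] theorem mem_prism (X : SimpleGraph W) (x : W) (R : ℕ) (c : Site 2) (ℓ : ℕ) (v : W × Site 2) :
    v ∈ prism X x R c ℓ ↔ v.1 ∈ graphBall X x R ∧ v.2 - c ∈ box 2 ℓ :=
  Iff.rfl

/-- A prism centred on the skeleton origin lies in the tube of the same half-width. [folklore] -/
theorem prism_zero_subset_tube (X : SimpleGraph W) (x : W) (R ℓ : ℕ) : prism X x R 0 ℓ ⊆ tube W ℓ := by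
  intro v hv
  rw [mem_prism, sub_zero] at hv
  exact hv.2

/-- Prisms are finite when `X` is locally finite (finite fibre ball times finite square). [folklore] -/
theorem prism_finite (X : SimpleGraph W) [X.LocallyFinite] (x : W) (R : ℕ) (c : Site 2) (ℓ : ℕ) :
    (prism X x R c ℓ).Finite := by
  have h1 : (graphBall X x R).Finite := Literature.Barriers.CriticalPhenomena.graphBall_finite X x R
  have h2 : {t : Site 2 | t - c ∈ box 2 ℓ}.Finite := by
    have : {t : Site 2 | t - c ∈ box 2 ℓ} = (fun s => s + c) '' (box 2 ℓ : Set (Site 2)) := by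
      ext t
      simp only [Set.mem_setOf_eq, Set.mem_image, Finset.mem_coe]
      constructor
      · intro ht; exact ⟨t - c, ht, sub_add_cancel t c⟩
      · rintro ⟨s, hs, rfl⟩; simpa using hs
    rw [this]; exact (box 2 ℓ).finite_toSet.image _
  exact (h1.prod h2).subset fun v hv => ⟨hv.1, hv.2⟩

/-- **No tube percolates at density `p`**: for every half-width `ℓ` and every root `(w,0)`, Bernoulli bond
percolation on the INDUCED graph of `X □ ℤ²` on `X × {-ℓ,…,ℓ}²` has `θ = 0` at `p`.  At `p = p_c(X □ ℤ²)` and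
`X` infinite quasi-transitive this is a Martineau–Severo strict inequality (tree device p208012; instance
H₃ × ℤ²: p208587). [cite: MartineauSevero2019, Cor. 2.2] -/
def TubeSubcritical (X : SimpleGraph W) (p : unitInterval) : Prop :=
  ∀ (ℓ : ℕ) (w : W), theta ((X □ zdGraph 2).induce (tube W ℓ)) ⟨(w, (0 : Site 2)), mem_tube_zero w ℓ⟩ p = 0

end Transplant.BoxProdZ2

end Summit.CriticalPhenomena.PercolationContinuityZ3.Theorems

end
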